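import Summits.Ventures.CertifiedManyBodySolver.Downfold.EmeryFermiVelocityScaleIntervals
import HarnessLib

/-!
# The one-band scale at the Fermi surface, III: the kernel-decidable box rule `scaleCheck`, its soundness, the velocity
# faithfulness factor, and the piecewise-in-energy wrapper

Venture CertifiedManyBodySolver, cell `pub/hubbard-downfold` (stage S1), seat hubbard-downfold-mod-4 (technique B); namespace
`Summit.Ventures.CertifiedManyBodySolver.Downfold.Emery`. Everything here is PROVED. WHAT THIS IS NOT: a statement about any
material; no number lives here; `U = 0` band kinematics.

* `scaleCheck Δ₁ Δ₂ a₁ a₂ b₁ b₂ c₁ c₂ e₁ e₂ σ0 lo hi φ` — a plain conjunction of rational tests (images of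
  `EmeryFermiVelocityScaleIntervals`) decided by `decide +kernel`; SOUNDNESS `scaleT_mem_of_scaleCheck`: on the parameter sub-box
  × energy piece, at every zone contour point, `fsD, fsN, fsT > 0`, `∂_ε charCubic > 0` and the velocity-matched one-band scale
  `scaleT ∈ [lo, hi]`; VELOCITY FAITHFULNESS `scaleT_le_mul_scaleT_of_check`: any two Fermi points satisfy
  `scaleT(k) ≤ (1 + φ)·scaleT(k′)` — one `(t, t′)` reproduces the σ Fermi surface exactly (`EmeryFermiSurfaceShape`) and its Fermi
  velocity up to the factor `1 + φ`;
* `scaleCheckPieces` (uniform energy pieces `piecePt` of `EmeryFermiSurfaceRatioWindow`) with `scaleT_mem_of_scaleCheckPieces`,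
  `scaleT_le_mul_scaleT_of_checkPieces`.

Consumers: the point/box census files `EmeryFermiScale*` (typed 3BE one-body rows ⇒ certified object-E SCALE `t` at the own hole
count). Sources: [HybertsenSchluterChristensen1989, Eq. (1)]; [AndersenEtAl1995, §6]; interval arithmetic [folklore] (Moore 1966).
-/

noncomputable section

namespace Summit.Ventures.CertifiedManyBodySolver.Downfold.Emery

open Real Set NonemptyInterval

/-! ### §3.3 The checker and its soundness -/

/-- **`scaleCheck`** — the kernel-decidable box rule. Inputs: a parameter sub-box `Δ_pd ∈ [Δ₁, Δ₂]`,
`t_pd ∈ [a₁, a₂]`, `t_pp ∈ [b₁, b₂]`, `t_pp′ ∈ [c₁, c₂]`, an energy piece `[e₁, e₂]` (`e₁ ≥ 0`), a candidate nodal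
lower value `σ0` for `x + y`, a claimed window `[lo, hi]` for the velocity-matched scale `scaleT` and a claimed
anisotropy factor `φ ≥ 0`. A plain conjunction of rational tests: `fsN, fsD, fsT > 0` on the box; the `s`-range
`[σlo, σhi]` of the zone contour is consistent; `∂_ε charCubic ≥ d₀ > 0`; `scaleT ∈ [lo, hi]`;
`sup|dcharB|·(σhi − σlo) ≤ φ·d₀`. [folklore] -/
def scaleCheck (Δ₁ Δ₂ a₁ a₂ b₁ b₂ c₁ c₂ e₁ e₂ σ0 lo hi φ : ℚ) : Bool :=
  let IΔ := ihull Δ₁ Δ₂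
  let Ia := ihull a₁ a₂
  let Ib := ihull b₁ b₂
  let Ic := ihull c₁ c₂
  let Ie := ihull e₁ e₂
  decide (0 ≤ min e₁ e₂) && decide (0 ≤ φ) &&
  decide (0 < (ifsN Ia Ib Ic Ie).fst) && decide (0 < (ifsD IΔ Ia Ic Ie).fst) &&
  decide (0 < (iscale 4 (ifsD IΔ Ia Ic Ie)).fst) &&
  decide (0 < (iscale 16 (ifsN Ia Ib Ic Ie) + iscale 4 (ifsD IΔ Ia Ic Ie)).fst) &&
  decide (sigmaLo IΔ Ia Ib Ic Ie σ0 ≤ sigmaHi IΔ Ia Ib Ic Ie) &&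
  decide (0 < (idchar IΔ Ia Ib Ic Ie σ0).fst) && decide (0 < (ifsT IΔ Ia Ib Ic Ie).fst) &&
  decide (lo ≤ (iscaleT IΔ Ia Ib Ic Ie σ0).fst) && decide ((iscaleT IΔ Ia Ib Ic Ie σ0).snd ≤ hi) &&
  decide (max |(idcharB IΔ Ia Ib Ic Ie).fst| |(idcharB IΔ Ia Ib Ic Ie).snd| *
      (sigmaHi IΔ Ia Ib Ic Ie - sigmaLo IΔ Ia Ib Ic Ie σ0) ≤ φ * (idchar IΔ Ia Ib Ic Ie σ0).fst)
/-- **SOUNDNESS OF `scaleCheck`**: on the parameter sub-box × energy piece, at EVERY point of the zone contour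
(`0 ≤ x, y ≤ 1`, `charCubic = 0`): the cuprate-regime signs `fsD, fsN, fsT > 0`, a positive energy denominator
`∂_ε charCubic > 0` (the antibonding band disperses upward across the contour), and the velocity-matched one-band scale
`scaleT ∈ [lo, hi]`. [folklore] -/
theorem scaleT_mem_of_scaleCheck {Δ₁ Δ₂ a₁ a₂ b₁ b₂ c₁ c₂ e₁ e₂ σ0 lo hi φ : ℚ}
    (h : scaleCheck Δ₁ Δ₂ a₁ a₂ b₁ b₂ c₁ c₂ e₁ e₂ σ0 lo hi φ = true)
    {Δ tpd tpp c ε x y : ℝ} (hΔ : Δ ∈ Set.Icc (Δ₁ : ℝ) Δ₂) (ha : tpd ∈ Set.Icc (a₁ : ℝ) a₂)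
    (hb : tpp ∈ Set.Icc (b₁ : ℝ) b₂) (hc : c ∈ Set.Icc (c₁ : ℝ) c₂) (he : ε ∈ Set.Icc (e₁ : ℝ) e₂)
    (hx : x ∈ Set.Icc (0 : ℝ) 1) (hy : y ∈ Set.Icc (0 : ℝ) 1) (hP : charCubic Δ tpd tpp c x y ε = 0) :
    0 < fsD Δ tpd c ε ∧ 0 < fsN tpd tpp c ε ∧ 0 < fsT Δ tpd tpp c ε ∧ 0 < dcharCubic Δ tpd tpp c x y ε ∧
      scaleT Δ tpd tpp c x y ε ∈ Set.Icc (lo : ℝ) hi := by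
  simp only [scaleCheck, Bool.and_eq_true, decide_eq_true_eq] at h
  obtain ⟨⟨⟨⟨⟨⟨⟨⟨⟨⟨⟨he0, -⟩, hNq⟩, hDq⟩, h4⟩, h16⟩, -⟩, hdq⟩, hTq⟩, hlo⟩, hhi⟩, -⟩ := h
  obtain ⟨mcA, mD, mN, mT, mdcA, mdD, mdN⟩ := mem_images hΔ ha hb hc he
  have me := mem_ihull he
  have hε : 0 ≤ ε := by
    have h1 : (((min e₁ e₂ : ℚ) : ℝ)) ≤ ε := (mem_ratCast_iff.mp me).1
    have h0 : (0 : ℝ) ≤ ((min e₁ e₂ : ℚ) : ℝ) := by exact_mod_cast he0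
    exact h0.trans h1
  have hN : 0 < fsN tpd tpp c ε := lt_of_lt_of_le (by exact_mod_cast hNq) (mem_ratCast_iff.mp mN).1
  have hD : 0 < fsD Δ tpd c ε := lt_of_lt_of_le (by exact_mod_cast hDq) (mem_ratCast_iff.mp mD).1
  have hT : 0 < fsT Δ tpd tpp c ε := lt_of_lt_of_le (by exact_mod_cast hTq) (mem_ratCast_iff.mp mT).1
  -- the affine coefficients
  have m4 : (4 : ℝ) ∈ (NonemptyInterval.pure (4 : ℚ)).ratCast ℝ := mem_pure_of_cast_eq (by norm_num)
  have mA : dcharA Δ tpd tpp c ε ∈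
      (idcharA (ihull Δ₁ Δ₂) (ihull a₁ a₂) (ihull b₁ b₂) (ihull c₁ c₂) (ihull e₁ e₂)).ratCast ℝ := by
    unfold dcharA idcharA
    exact mem_ratCast_sub mdcA (mem_idivPos hNq (mem_ratCast_mul mdN mcA) mN)
  have mB : dcharB Δ tpd tpp c ε ∈
      (idcharB (ihull Δ₁ Δ₂) (ihull a₁ a₂) (ihull b₁ b₂) (ihull c₁ c₂) (ihull e₁ e₂)).ratCast ℝ := by
    unfold dcharB idcharB
    have mneg4 := mem_iscale (-4) mdD
    have m4D := mem_iscale 4 mD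
    push_cast at mneg4 m4D
    exact mem_ratCast_add mneg4 (mem_idivPos hNq (mem_ratCast_mul m4D mdN) mN)
  -- the s-range
  have hslo := sigmaLo_le_sum (σ0 := σ0) mcA mD mN hN hD hNq hDq hx.1 hy.1 hP
  have hshi := sum_le_sigmaHi mcA mD mN hN hD h4 h16 hε hx hy hP
  have ms := mem_ihull ⟨hslo, hshi⟩
  -- the energy denominator and the scale
  have md : dcharCubic Δ tpd tpp c x y ε ∈
      (idchar (ihull Δ₁ Δ₂) (ihull a₁ a₂) (ihull b₁ b₂) (ihull c₁ c₂) (ihull e₁ e₂) σ0).ratCast ℝ := by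
    rw [dcharCubic_eq_affine hN.ne' hP]
    unfold idchar
    exact mem_ratCast_add mA (mem_ratCast_mul mB ms)
  have hd : 0 < dcharCubic Δ tpd tpp c x y ε := lt_of_lt_of_le (by exact_mod_cast hdq) (mem_ratCast_iff.mp md).1
  have mt : scaleT Δ tpd tpp c x y ε ∈
      (iscaleT (ihull Δ₁ Δ₂) (ihull a₁ a₂) (ihull b₁ b₂) (ihull c₁ c₂) (ihull e₁ e₂) σ0).ratCast ℝ := by
    unfold scaleT iscaleT
    exact mem_idivPos hdq mT md
  rw [mem_ratCast_iff] at mt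
  refine ⟨hD, hN, hT, hd, ?_, ?_⟩
  · exact le_trans (by exact_mod_cast hlo) mt.1
  · exact mt.2.trans (by exact_mod_cast hhi)

/-- **VELOCITY FAITHFULNESS** (soundness of the anisotropy factor `φ` of `scaleCheck`): for any two points `k, k′` of
the same zone contour, `scaleT(k) ≤ (1 + φ)·scaleT(k′)` — one energy-independent `(t, t′)` pair reproduces the σ Fermi
surface exactly and its Fermi velocity everywhere up to the factor `1 + φ`. [folklore] -/
theorem scaleT_le_mul_scaleT_of_check {Δ₁ Δ₂ a₁ a₂ b₁ b₂ c₁ c₂ e₁ e₂ σ0 lo hi φ : ℚ}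
    (h : scaleCheck Δ₁ Δ₂ a₁ a₂ b₁ b₂ c₁ c₂ e₁ e₂ σ0 lo hi φ = true)
    {Δ tpd tpp c ε x y x' y' : ℝ} (hΔ : Δ ∈ Set.Icc (Δ₁ : ℝ) Δ₂) (ha : tpd ∈ Set.Icc (a₁ : ℝ) a₂)
    (hb : tpp ∈ Set.Icc (b₁ : ℝ) b₂) (hc : c ∈ Set.Icc (c₁ : ℝ) c₂) (he : ε ∈ Set.Icc (e₁ : ℝ) e₂)
    (hx : x ∈ Set.Icc (0 : ℝ) 1) (hy : y ∈ Set.Icc (0 : ℝ) 1) (hP : charCubic Δ tpd tpp c x y ε = 0)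
    (hx' : x' ∈ Set.Icc (0 : ℝ) 1) (hy' : y' ∈ Set.Icc (0 : ℝ) 1) (hP' : charCubic Δ tpd tpp c x' y' ε = 0) :
    scaleT Δ tpd tpp c x y ε ≤ (1 + φ) * scaleT Δ tpd tpp c x' y' ε := by
  obtain ⟨hD, hN, hT, hd, -⟩ := scaleT_mem_of_scaleCheck h hΔ ha hb hc he hx hy hP
  obtain ⟨-, -, -, hd', -⟩ := scaleT_mem_of_scaleCheck h hΔ ha hb hc he hx' hy' hP'
  simp only [scaleCheck, Bool.and_eq_true, decide_eq_true_eq] at h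
  obtain ⟨⟨⟨⟨⟨⟨⟨⟨⟨⟨⟨he0, hφ⟩, hNq⟩, hDq⟩, h4⟩, h16⟩, -⟩, hdq⟩, -⟩, -⟩, -⟩, hani⟩ := h
  obtain ⟨mcA, mD, mN, mT, mdcA, mdD, mdN⟩ := mem_images hΔ ha hb hc he
  have me := mem_ihull he
  have hε : 0 ≤ ε := by
    have h1 : (((min e₁ e₂ : ℚ) : ℝ)) ≤ ε := (mem_ratCast_iff.mp me).1
    have h0 : (0 : ℝ) ≤ ((min e₁ e₂ : ℚ) : ℝ) := by exact_mod_cast he0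
    exact h0.trans h1
  have mB : dcharB Δ tpd tpp c ε ∈
      (idcharB (ihull Δ₁ Δ₂) (ihull a₁ a₂) (ihull b₁ b₂) (ihull c₁ c₂) (ihull e₁ e₂)).ratCast ℝ := by
    unfold dcharB idcharB
    have mneg4 := mem_iscale (-4) mdD
    have m4D := mem_iscale 4 mD
    push_cast at mneg4 m4D
    exact mem_ratCast_add mneg4 (mem_idivPos hNq (mem_ratCast_mul m4D mdN) mN)
  have mA : dcharA Δ tpd tpp c ε ∈
      (idcharA (ihull Δ₁ Δ₂) (ihull a₁ a₂) (ihull b₁ b₂) (ihull c₁ c₂) (ihull e₁ e₂)).ratCast ℝ := by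
    unfold dcharA idcharA
    exact mem_ratCast_sub mdcA (mem_idivPos hNq (mem_ratCast_mul mdN mcA) mN)
  -- s-ranges of both points
  have hslo := sigmaLo_le_sum (σ0 := σ0) mcA mD mN hN hD hNq hDq hx.1 hy.1 hP
  have hshi := sum_le_sigmaHi mcA mD mN hN hD h4 h16 hε hx hy hP
  have hslo' := sigmaLo_le_sum (σ0 := σ0) mcA mD mN hN hD hNq hDq hx'.1 hy'.1 hP'
  have hshi' := sum_le_sigmaHi mcA mD mN hN hD h4 h16 hε hx' hy' hP'
  -- |dchar(k') − dchar(k)| ≤ sup|B|·(σhi − σlo) ≤ φ·d₀ ≤ φ·dchar(k)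
  set Bq := idcharB (ihull Δ₁ Δ₂) (ihull a₁ a₂) (ihull b₁ b₂) (ihull c₁ c₂) (ihull e₁ e₂) with hBq
  set σl := sigmaLo (ihull Δ₁ Δ₂) (ihull a₁ a₂) (ihull b₁ b₂) (ihull c₁ c₂) (ihull e₁ e₂) σ0 with hσl
  set σh := sigmaHi (ihull Δ₁ Δ₂) (ihull a₁ a₂) (ihull b₁ b₂) (ihull c₁ c₂) (ihull e₁ e₂) with hσh
  set Idq := idchar (ihull Δ₁ Δ₂) (ihull a₁ a₂) (ihull b₁ b₂) (ihull c₁ c₂) (ihull e₁ e₂) σ0 with hIdq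
  rw [mem_ratCast_iff] at mB
  have hBabs : |dcharB Δ tpd tpp c ε| ≤ ((max |Bq.fst| |Bq.snd| : ℚ) : ℝ) := by
    push_cast
    exact abs_le_max_abs_abs mB.1 mB.2
  have hds : |(x' + y') - (x + y)| ≤ ((σh : ℝ)) - (σl : ℝ) := by
    rw [abs_sub_le_iff]; constructor <;> linarith
  have hdiff : dcharCubic Δ tpd tpp c x' y' ε - dcharCubic Δ tpd tpp c x y ε ≤
      ((max |Bq.fst| |Bq.snd| : ℚ) : ℝ) * (((σh : ℝ)) - (σl : ℝ)) := by
    rw [dcharCubic_sub_eq hN.ne' hP' hP]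
    calc dcharB Δ tpd tpp c ε * ((x' + y') - (x + y))
        ≤ |dcharB Δ tpd tpp c ε * ((x' + y') - (x + y))| := le_abs_self _
      _ = |dcharB Δ tpd tpp c ε| * |(x' + y') - (x + y)| := abs_mul _ _
      _ ≤ ((max |Bq.fst| |Bq.snd| : ℚ) : ℝ) * (((σh : ℝ)) - (σl : ℝ)) :=
          mul_le_mul hBabs hds (abs_nonneg _) (le_trans (abs_nonneg _) hBabs)
  have hani' : ((max |Bq.fst| |Bq.snd| : ℚ) : ℝ) * (((σh : ℝ)) - (σl : ℝ)) ≤ (φ : ℝ) * ((Idq.fst : ℚ) : ℝ) := by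
    have := hani
    exact_mod_cast this
  -- dchar(k) ≥ d₀
  have ms := mem_ihull ⟨hslo, hshi⟩
  have md : dcharCubic Δ tpd tpp c x y ε ∈ Idq.ratCast ℝ := by
    rw [dcharCubic_eq_affine hN.ne' hP, hIdq]
    unfold idchar
    exact mem_ratCast_add mA (mem_ratCast_mul (by rw [mem_ratCast_iff]; exact mB) ms)
  have hd0 : ((Idq.fst : ℚ) : ℝ) ≤ dcharCubic Δ tpd tpp c x y ε := (mem_ratCast_iff.mp md).1
  have hφ' : (0 : ℝ) ≤ (φ : ℝ) := by exact_mod_cast hφ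
  have hφd : (φ : ℝ) * ((Idq.fst : ℚ) : ℝ) ≤ (φ : ℝ) * dcharCubic Δ tpd tpp c x y ε :=
    mul_le_mul_of_nonneg_left hd0 hφ'
  have hkey : dcharCubic Δ tpd tpp c x' y' ε ≤ (1 + (φ : ℝ)) * dcharCubic Δ tpd tpp c x y ε := by
    have : dcharCubic Δ tpd tpp c x' y' ε - dcharCubic Δ tpd tpp c x y ε ≤ (φ : ℝ) * dcharCubic Δ tpd tpp c x y ε :=
      hdiff.trans (hani'.trans hφd)
    linarith
  -- conclude on the quotients
  unfold scaleT
  rw [← mul_div_assoc, div_le_div_iff₀ hd hd']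
  nlinarith [mul_le_mul_of_nonneg_left hkey hT.le]

/-! ### §3.4 Piecewise in the energy -/

/-- `scaleCheck` on each of `m` uniform energy pieces of `[e_a, e_b]` (candidate nodal values `σ0s`, one per piece,
default `0`), all against the same window `[lo, hi]` and factor `φ`. [folklore] -/
def scaleCheckPieces (Δ₁ Δ₂ a₁ a₂ b₁ b₂ c₁ c₂ ea eb : ℚ) (m : ℕ) (σ0s : List ℚ) (lo hi φ : ℚ) : Bool :=
  decide (0 < m) && decide (ea ≤ eb) &&
  (List.range m).all fun j =>
    scaleCheck Δ₁ Δ₂ a₁ a₂ b₁ b₂ c₁ c₂ (piecePt ea eb m j) (piecePt ea eb m (j + 1)) (σ0s.getD j 0) lo hi φ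

/-- **Soundness of `scaleCheckPieces`**: for every energy of the bracket `[e_a, e_b]` and every zone contour point, the
signs, the positive denominator and `scaleT ∈ [lo, hi]`. [folklore] -/
theorem scaleT_mem_of_scaleCheckPieces {Δ₁ Δ₂ a₁ a₂ b₁ b₂ c₁ c₂ ea eb lo hi φ : ℚ} {m : ℕ} {σ0s : List ℚ}
    (h : scaleCheckPieces Δ₁ Δ₂ a₁ a₂ b₁ b₂ c₁ c₂ ea eb m σ0s lo hi φ = true)
    {Δ tpd tpp c ε x y : ℝ} (hΔ : Δ ∈ Set.Icc (Δ₁ : ℝ) Δ₂) (ha : tpd ∈ Set.Icc (a₁ : ℝ) a₂)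
    (hb : tpp ∈ Set.Icc (b₁ : ℝ) b₂) (hc : c ∈ Set.Icc (c₁ : ℝ) c₂) (he : ε ∈ Set.Icc (ea : ℝ) eb)
    (hx : x ∈ Set.Icc (0 : ℝ) 1) (hy : y ∈ Set.Icc (0 : ℝ) 1) (hP : charCubic Δ tpd tpp c x y ε = 0) :
    0 < fsD Δ tpd c ε ∧ 0 < fsN tpd tpp c ε ∧ 0 < fsT Δ tpd tpp c ε ∧ 0 < dcharCubic Δ tpd tpp c x y ε ∧
      scaleT Δ tpd tpp c x y ε ∈ Set.Icc (lo : ℝ) hi := by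
  simp only [scaleCheckPieces, Bool.and_eq_true, decide_eq_true_eq, List.all_eq_true, List.mem_range] at h
  obtain ⟨⟨hm, hab⟩, hall⟩ := h
  obtain ⟨j, hj, hj1, hj2⟩ := exists_pieceIndex hm hab he
  exact scaleT_mem_of_scaleCheck (hall j hj) hΔ ha hb hc ⟨hj1, hj2⟩ hx hy hP

/-- Piecewise velocity faithfulness: for every energy of the bracket, any two zone contour points satisfy
`scaleT(k) ≤ (1 + φ)·scaleT(k′)`. [folklore] -/
theorem scaleT_le_mul_scaleT_of_checkPieces {Δ₁ Δ₂ a₁ a₂ b₁ b₂ c₁ c₂ ea eb lo hi φ : ℚ} {m : ℕ} {σ0s : List ℚ}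
    (h : scaleCheckPieces Δ₁ Δ₂ a₁ a₂ b₁ b₂ c₁ c₂ ea eb m σ0s lo hi φ = true)
    {Δ tpd tpp c ε x y x' y' : ℝ} (hΔ : Δ ∈ Set.Icc (Δ₁ : ℝ) Δ₂) (ha : tpd ∈ Set.Icc (a₁ : ℝ) a₂)
    (hb : tpp ∈ Set.Icc (b₁ : ℝ) b₂) (hc : c ∈ Set.Icc (c₁ : ℝ) c₂) (he : ε ∈ Set.Icc (ea : ℝ) eb)
    (hx : x ∈ Set.Icc (0 : ℝ) 1) (hy : y ∈ Set.Icc (0 : ℝ) 1) (hP : charCubic Δ tpd tpp c x y ε = 0)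
    (hx' : x' ∈ Set.Icc (0 : ℝ) 1) (hy' : y' ∈ Set.Icc (0 : ℝ) 1) (hP' : charCubic Δ tpd tpp c x' y' ε = 0) :
    scaleT Δ tpd tpp c x y ε ≤ (1 + φ) * scaleT Δ tpd tpp c x' y' ε := by
  simp only [scaleCheckPieces, Bool.and_eq_true, decide_eq_true_eq, List.all_eq_true, List.mem_range] at h
  obtain ⟨⟨hm, hab⟩, hall⟩ := h
  obtain ⟨j, hj, hj1, hj2⟩ := exists_pieceIndex hm hab he
  exact scaleT_le_mul_scaleT_of_check (hall j hj) hΔ ha hb hc ⟨hj1, hj2⟩ hx hy hP hx' hy' hP'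

end Summit.Ventures.CertifiedManyBodySolver.Downfold.Emery
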